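import Literature.IUT.HodgeTheaters.StableCurveTemperedDataOfSpecialFibre
import Literature.IUT.HodgeTheaters.TemperedCoveringsProp24QInvLimit
import Literature.AnabelianGeometry.SemiGraphs.TemperedSpecialFibreTower
import Mathlib.Topology.Algebra.Group.ClosedSubgroup
import HarnessLib

/-!
# The Prop. 2.4 (ii) quotient tower of the genuine [IUTchI] §2 𝔛-datum, from the special-fibre tower

Mochizuki, *Inter-universal Teichmüller theory I*, kurims manuscript (May 2020), §2, Proposition 2.4 (ii)
and its proof, p. 50 l. 43 – p. 51 l. 13: "by applying this observation to the quotients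
`Π^tp_X/Ker(J ↠ Π^tp_{𝔾*_J}) ↪ Π̂_X/Ker(Δ̂_X ↠ Π̂_{𝔾*_J})` — where `𝔾*_J` is the semi-graph of
anabelioids whose finite étale coverings correspond to arbitrary admissible coverings of the special
fiber [cf. [SemiAnbd], Example 5.6] — we conclude that `γ` lies in `Π^tp_X`, as desired"
([IUTchI] Prop 2.4(ii) pp.50-51) [claim: Mochizuki2012, status: disputed] (D-0012 claim key; nothing of
the series is asserted here); [SemiAnbd] Example 3.10 pp. 44–45, Example 5.6 p. 67 (the special-fibre
tower `Δ ↠ ⋯ ↠ Δ[i] ↠ ⋯`, the admissible kernels) [cite: MochizukiSemiAnbd2006, Ex 3.10 pp.44-45].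

BRIDGE + NON-VACUITY at the GENUINE datum (abc-iut cell; NV-L5 row `StableCurveTemperedData.Prop24QTower`,
abc-iut-L5-lead RULINGS #34 (2) «levelData-ofSpecialFibre», seat abc-iut-w4-d063; sequel of
abc-iut-L5-t11's `StableCurveTemperedDataOfSpecialFibre.lean` (the 𝔛-datum `ofSpecialFibre X d S …`) over
L3's `SpecialFibreTower` (abc-iut-L3, Example 3.10: levels `N_i`, admissible kernels `admKer i ⊴ Δ^temp_X`)).
For a tempered curve `X` with parameter bundle `d`, special-fibre data `S` and a special-fibre tower
`T : SpecialFibreTower ↥X.DeltaTemp`: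

* `admKerPi X T i ≤ Π^temp_{X_K}` / `admKerHat X T i ≤ Π_{X_K}` — the admissible kernel of level `i`
  read in `Π^tp_X` and its closure `Ker(Δ̂_X ↠ Π̂_{𝔾*_i})` in `Π̂_X`;
* `comap_admKerHat` — **the admissible kernel is closed for the profinite topology**:
  `ι⁻¹(closure ι(admKer_i)) = admKer_i` (hypothesis-free: `π₁^temp(𝒢_i)` injects into its profinite
  completion, abc-iut-L3-t7's `exists_completion_of_prop36`; `N_i` and the normal core of a separating
  open subgroup are preimages of opens of `Δ_X`, abc-iut-w5-d139's `isProfiniteCompletion_deltaToHat`;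
  `Δ^temp_X = ι⁻¹(Δ_X)`, `ker_augHat_eq_deltaHat`) — so the level quotient pair is INJECTIVE;
* `levelQuotient … hP0 i : TemperedGraphGroupData` — the pair
  `Π^tp_X/admKer_i ↪ Π̂_X/closure ι(admKer_i)` (compact quotient; `Π^tp_ℍ := ⊤` — (ii) has no `ℍ`), and
  **`qTowerOfSpecialFibreTower … hP0 : (ofSpecialFibre X d S …).Prop24QTower`**, the quotient tower with
  `qtp`, `qhat` the quotient maps — MODULO the one binder
  **(P0) `hP0 : ∀ i, (admKerPi X T i).Normal`** (the admissible kernels are normal in `Π^temp_{X_K}`,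
  not only in `Δ^temp_X` as `SpecialFibreTower.admKer_normal` records; print: `X_{N_i} → X_K` is Galois
  and admissible coverings of its special fibre are intrinsic — GAP-LEDGER G-w4d063-1 (P0), interface
  data of the geometric origin);
* `qTower_qDetectsTempered` — the (INV) law `QDetectsTempered` of abc-iut-w5-d119's sub-DAG for THIS tower
  from abc-iut-w4-d055's `qDetectsTempered_of_inverseLimit`: `hsep` (`⋂_i Ker q̂_i = 1`) is PROVED from
  the cofinality of the levels (`hcof`, as in abc-iut-L5-t11's tower laws) and `hlim` is the tempered
  completeness "`Π^tp_X = lim Π^tp_X/Ker(J ↠ Π^tp_{𝔾*_J})`" (p. 51 l. 8–10) in coset form — a named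
  binder, not recorded by `SpecialFibreTower` either;
* `prop24ii_ofSpecialFibre_of_qTower` — Prop. 2.4 (ii) AS TYPED at the genuine datum from
  `LevelObservation` (the arithmetic Prop. 2.1 per level = [SemiAnbd] Thm 5.4 (ii) / Ex 5.6 input, the
  analytic content) + (P0) + `hcof` + `hlim`.

HONEST LABEL: `_model` MODULO (P0) — every level quotient is the genuine Π-level quotient by the admissible
kernel; the file asserts nothing about a particular curve (model-relative: ∀ `X`, `d`, `S`, `T`).  Nothing
here bears on [IUTchIII] Cor. 3.12; typed ≠ discharged; instantiated ≠ endorsed.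
-/

noncomputable section

namespace Literature.IUT.HodgeTheaters

namespace StableCurveTemperedData

namespace OfSpecialFibre

open Topology
open scoped Pointwise
open Literature.AnabelianGeometry.SemiGraphs Literature.AnabelianGeometry.SemiGraphs.ProfiniteSemiGraph

variable {p : ℕ} [Fact p.Prime] (X : TemperedCurve p) (T : SpecialFibreTower ↥X.DeltaTemp)

/-! ### The admissible kernels in `Π^temp_{X_K}` and their closures in `Π_{X_K}` -/

/-- The admissible kernel `admKer_i = Ker(N_i ↠ π₁^temp(𝒢_i))` of level `i`, read in `Π^temp_{X_K}`
("`Ker(J ↠ Π^tp_{𝔾*_J})`", p. 51 l. 1). ([IUTchI] Prop 2.4(ii) p.51) [claim: Mochizuki2012, status: disputed] -/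
def admKerPi (i : ℕ) : Subgroup X.PiTemp := (T.admKer i).map X.DeltaTemp.subtype

/-- Its closure in `Π_{X_K}` ("`Ker(Δ̂_X ↠ Π̂_{𝔾*_J})`", p. 51 l. 2). ([IUTchI] Prop 2.4(ii) p.51) [claim: Mochizuki2012, status: disputed] -/
def admKerHat (i : ℕ) : Subgroup X.PiHat :=
  ((admKerPi X T i).map X.toHat.toMonoidHom).topologicalClosure

/-- `admKer_i ≤ Δ^temp_X`. ([IUTchI] Prop 2.4(ii) p.51) [claim: Mochizuki2012, status: disputed] -/
theorem admKerPi_le_deltaTemp (i : ℕ) : admKerPi X T i ≤ X.DeltaTemp := by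
  rintro _ ⟨a, -, rfl⟩
  exact a.2

/-- Membership in `admKerPi`: for `δ ∈ Δ^temp_X`, `(δ : Π^temp) ∈ admKerPi ↔ δ ∈ admKer_i`.
([IUTchI] Prop 2.4(ii) p.51) [claim: Mochizuki2012, status: disputed] -/
theorem mem_admKerPi_iff (i : ℕ) (δ : X.DeltaTemp) : (δ : X.PiTemp) ∈ admKerPi X T i ↔ δ ∈ T.admKer i := by
  constructor
  · rintro ⟨a, ha, h⟩
    have : a = δ := Subtype.ext h
    exact this ▸ ha
  · exact fun h => ⟨δ, h, rfl⟩

/-- `admKer_i ≤ N_i` read in `Π^temp_{X_K}`. ([IUTchI] Prop 2.4(ii) p.51) [claim: Mochizuki2012, status: disputed] -/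
theorem admKerPi_le_map_N (i : ℕ) : admKerPi X T i ≤ (T.N i).map X.DeltaTemp.subtype :=
  Subgroup.map_mono (T.admKer_le i)

/-- `ι(admKer_i) ≤ closure`, i.e. `admKerPi ≤ ι⁻¹(admKerHat)`. ([IUTchI] Prop 2.4(ii) p.51) [claim: Mochizuki2012, status: disputed] -/
theorem admKerPi_le_comap_admKerHat (i : ℕ) :
    admKerPi X T i ≤ (admKerHat X T i).comap X.toHat.toMonoidHom :=
  Subgroup.map_le_iff_le_comap.mp (Subgroup.le_topologicalClosure _)

/-- `admKerHat ≤ Δ_X`. ([IUTchI] Prop 2.4(ii) p.51) [claim: Mochizuki2012, status: disputed] -/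
theorem admKerHat_le_deltaHat (i : ℕ) : admKerHat X T i ≤ X.DeltaHat :=
  Subgroup.topologicalClosure_minimal _
    ((Subgroup.map_mono (admKerPi_le_deltaTemp X T i)).trans (Subgroup.le_topologicalClosure _))
    (Subgroup.isClosed_topologicalClosure _)

/-- The closure of the image of a NORMAL subgroup under a dense-range continuous homomorphism is
normal (closed + conjugated into itself by the dense image). [folklore] -/
private theorem normal_topologicalClosure_map_of_denseRange {G H : Type*} [Group G] [TopologicalSpace G]
    [Group H] [TopologicalSpace H] [IsTopologicalGroup H] (f : G →* H)
    (hd : DenseRange f) (N : Subgroup G) [N.Normal] : ((N.map f).topologicalClosure).Normal := by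
  refine ⟨fun n hn g => ?_⟩
  -- conjugation by an element of the dense image preserves the closure
  have hx : ∀ (x : G), ∀ m ∈ (N.map f).topologicalClosure,
      f x * m * (f x)⁻¹ ∈ (N.map f).topologicalClosure := by
    intro x m hm
    have hle : N.map f ≤ ((N.map f).topologicalClosure).comap (MulAut.conj (f x)).toMonoidHom := by
      rintro _ ⟨y, hy, rfl⟩
      rw [Subgroup.mem_comap]
      change f x * f y * (f x)⁻¹ ∈ _
      exact Subgroup.le_topologicalClosure _
        ⟨x * y * x⁻¹, Subgroup.Normal.conj_mem inferInstance y hy x, by simp only [map_mul, map_inv]⟩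
    have hcl : IsClosed ((((N.map f).topologicalClosure).comap (MulAut.conj (f x)).toMonoidHom :
        Subgroup H) : Set H) :=
      (Subgroup.isClosed_topologicalClosure _).preimage (IsTopologicalGroup.continuous_conj (f x))
    exact (Subgroup.topologicalClosure_minimal _ hle hcl) hm
  -- the set of `g` conjugating `n` into the closure is closed and contains the dense image
  have hclosed : IsClosed {g : H | g * n * g⁻¹ ∈ (N.map f).topologicalClosure} := by
    have hc : Continuous fun g : H => g * n * g⁻¹ :=
      (continuous_id.mul continuous_const).mul continuous_inv
    exact (Subgroup.isClosed_topologicalClosure _).preimage hc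
  exact hclosed.closure_subset_iff.mpr (by rintro _ ⟨x, rfl⟩; exact hx x n hn) (hd g)

/-- Under (P0), the closure `admKerHat` is normal in `Π_{X_K}`. ([IUTchI] Prop 2.4(ii) p.51) [claim: Mochizuki2012, status: disputed] -/
theorem admKerHat_normal (i : ℕ) (hP0 : (admKerPi X T i).Normal) : (admKerHat X T i).Normal :=
  haveI := hP0
  normal_topologicalClosure_map_of_denseRange X.toHat.toMonoidHom
    X.isProfiniteCompletion_toHat.denseRange (admKerPi X T i)

/-! ### The admissible kernel is closed for the profinite topology -/

/-- `Δ^temp_X = ι⁻¹(Δ_X)` (exactness of the completed sequence, `ker_augHat_eq_deltaHat`).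
[cite: MochizukiSemiAnbd2006, §6 p.69] -/
theorem mem_deltaTemp_of_toHat_mem_deltaHat (d : X.GroupLevelData) {t : X.PiTemp}
    (ht : X.toHat t ∈ X.DeltaHat) : t ∈ X.DeltaTemp := by
  rw [← X.ker_augHat_eq_deltaHat d] at ht
  rw [MonoidHom.mem_ker] at ht
  change X.aug t = 1
  rw [← X.augHat_comp]
  exact ht

/-- Transfer of closures into the closed subgroup `Δ_X`: for `A ≤ Δ^temp_X` and `x ∈ Δ_X`, if
`(x : Π_X) ∈ closure ι(A)` then `x ∈ closure (deltaToHat A)` inside `Δ_X` (`Δ_X ↪ Π_X` is a closed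
embedding). [cite: MochizukiSemiAnbd2006, §6 p.69] -/
theorem mem_closure_deltaToHat_of_coe_mem (A : Subgroup X.DeltaTemp) (x : X.DeltaHat)
    (hx : (x : X.PiHat) ∈ ((A.map X.DeltaTemp.subtype).map X.toHat.toMonoidHom).topologicalClosure) :
    x ∈ (A.map X.deltaToHat.toMonoidHom).topologicalClosure := by
  -- `val : Δ_X → Π_X` is a closed embedding; closures correspond
  have hce : Topology.IsClosedEmbedding (Subtype.val : X.DeltaHat → X.PiHat) :=
    (Subgroup.isClosed_topologicalClosure _).isClosedEmbedding_subtypeVal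
  have himg : (Subtype.val : X.DeltaHat → X.PiHat) ''
      ((A.map X.deltaToHat.toMonoidHom : Subgroup X.DeltaHat) : Set X.DeltaHat) =
      (((A.map X.DeltaTemp.subtype).map X.toHat.toMonoidHom : Subgroup X.PiHat) : Set X.PiHat) := by
    ext y
    simp only [Set.mem_image, SetLike.mem_coe, Subgroup.mem_map]
    constructor
    · rintro ⟨_, ⟨a, ha, rfl⟩, rfl⟩
      exact ⟨(a : X.PiTemp), ⟨a, ha, rfl⟩, rfl⟩
    · rintro ⟨_, ⟨a, ha, rfl⟩, rfl⟩
      exact ⟨X.deltaToHat a, ⟨a, ha, rfl⟩, rfl⟩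
  have : (x : X.PiHat) ∈ closure ((Subtype.val : X.DeltaHat → X.PiHat) ''
      ((A.map X.deltaToHat.toMonoidHom : Subgroup X.DeltaHat) : Set X.DeltaHat)) := by
    rw [himg]; exact hx
  rw [hce.closure_image_eq] at this
  obtain ⟨s, hs, hst⟩ := this
  have : s = x := Subtype.ext hst
  rw [← this]
  exact hs

/-- The case of a tempered element: `ι t ∈ closure ι(A)` with `t ∈ Δ^temp_X` gives
`deltaToHat t ∈ closure (deltaToHat A)`. [cite: MochizukiSemiAnbd2006, §6 p.69] -/
theorem deltaToHat_mem_closure_of_toHat_mem (A : Subgroup X.DeltaTemp) (t : X.DeltaTemp)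
    (ht : X.toHat (t : X.PiTemp) ∈ ((A.map X.DeltaTemp.subtype).map X.toHat.toMonoidHom).topologicalClosure) :
    X.deltaToHat t ∈ (A.map X.deltaToHat.toMonoidHom).topologicalClosure :=
  mem_closure_deltaToHat_of_coe_mem X A (X.deltaToHat t) ht

/-- **The admissible kernel `admKer_i` is closed for the profinite topology on `Π^temp_{X_K}`**:
`ι⁻¹(closure ι(admKer_i)) = admKer_i` — the injectivity of the level quotient pair
`Π^tp_X/Ker(J ↠ Π^tp_{𝔾*_J}) ↪ Π̂_X/Ker(Δ̂_X ↠ Π̂_{𝔾*_J})` (p. 51 l. 1–3).  Hypothesis-free over the interfaces: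
`π₁^temp(𝒢_i)` injects into its profinite completion (`exists_completion_of_prop36`), so an element of
`N_i` off `admKer_i` is separated from `admKer_i` by an open finite-index subgroup of `Δ^temp_X` whose
normal core is the preimage of an open subgroup of `Δ_X` (`isProfiniteCompletion_deltaToHat`); `N_i` is
such a preimage too, and `Δ^temp_X = ι⁻¹(Δ_X)`. ([IUTchI] Prop 2.4(ii) p.51) [claim: Mochizuki2012, status: disputed] -/
theorem comap_admKerHat (d : X.GroupLevelData) (i : ℕ) :
    (admKerHat X T i).comap X.toHat.toMonoidHom = admKerPi X T i := by
  classical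
  refine le_antisymm ?_ (admKerPi_le_comap_admKerHat X T i)
  intro t ht
  rw [Subgroup.mem_comap] at ht
  have hΔc := X.isProfiniteCompletion_deltaToHat d
  haveI : CompactSpace X.DeltaHat := hΔc.compactSpace
  haveI : T2Space X.DeltaHat := hΔc.t2Space
  haveI : TotallyDisconnectedSpace X.DeltaHat := hΔc.totallyDisconnectedSpace
  -- Step 1: `t ∈ Δ^temp_X`
  have htΔ : t ∈ X.DeltaTemp :=
    mem_deltaTemp_of_toHat_mem_deltaHat X d (admKerHat_le_deltaHat X T i ht)
  set δ : X.DeltaTemp := ⟨t, htΔ⟩ with hδdef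
  -- Step 2: `deltaToHat δ ∈ closure (deltaToHat admKer_i)` inside `Δ_X`
  have hδcl : X.deltaToHat δ ∈ ((T.admKer i).map X.deltaToHat.toMonoidHom).topologicalClosure :=
    deltaToHat_mem_closure_of_toHat_mem X (T.admKer i) δ ht
  -- a tool: an open finite-index normal subgroup `C` of `Δ^temp_X` containing `admKer_i` and CLOSED under
  -- the test `δ ∈ closure ⇒ δ ∈ C`
  have closed_of_preimage : ∀ (C : Subgroup X.DeltaTemp) (V : OpenNormalSubgroup X.DeltaHat),
      C = V.toSubgroup.comap X.deltaToHat.toMonoidHom → T.admKer i ≤ C → δ ∈ C := by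
    intro C V hC hle
    rw [hC, Subgroup.mem_comap]
    have hsub : ((T.admKer i).map X.deltaToHat.toMonoidHom) ≤ V.toSubgroup := by
      rw [Subgroup.map_le_iff_le_comap, ← hC]; exact hle
    exact (Subgroup.topologicalClosure_minimal _ hsub
      (OpenSubgroup.isClosed V.toOpenSubgroup)) hδcl
  -- Step 3: `δ ∈ N_i`
  have hNi : δ ∈ T.N i := by
    haveI : (T.N i).Normal := T.N_normal i
    haveI : (T.N i).FiniteIndex := T.N_finiteIndex i
    let Ni : OpenNormalSubgroup X.DeltaTemp := { toOpenSubgroup := ⟨T.N i, T.isOpen_N i⟩ }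
    obtain ⟨V, hV⟩ := hΔc.comap_surjective Ni (T.N_finiteIndex i)
    exact closed_of_preimage (T.N i) V hV (T.admKer_le i)
  -- Step 4: `δ ∈ admKer_i`
  suffices hadm : δ ∈ T.admKer i from (mem_admKerPi_iff X T i δ).mpr hadm
  by_contra hδA
  -- `y := adm_i δ ≠ 1`, separated by an open finite-index subgroup of the chart
  set y : (T.chart i).G := T.adm i ⟨δ, hNi⟩ with hydef
  have hy : y ≠ 1 := by
    intro h1
    have : (⟨δ, hNi⟩ : T.N i) ∈ (T.adm i).toMonoidHom.ker := h1
    rw [T.ker_adm i, Subgroup.mem_subgroupOf] at this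
    exact hδA this
  obtain ⟨P, ιG, hιG, hιinj⟩ :=
    TemperedGraphGroupData.exists_completion_of_prop36 (T.Gc i) (T.hyp i).toProp36Hypotheses (T.chart i)
  haveI : CompactSpace P := hιG.compactSpace
  haveI : T2Space P := hιG.t2Space
  haveI : TotallyDisconnectedSpace P := hιG.totallyDisconnectedSpace
  have hz : ιG y ≠ 1 := fun h => hy (hιinj (by rw [h, map_one]))
  obtain ⟨Vh, hVh⟩ := ProfiniteGrp.exist_openNormalSubgroup_sub_open_nhds_of_one
    (isOpen_compl_singleton (x := ιG y)) (show (1 : P) ∈ ({ιG y}ᶜ : Set P) from fun h => hz h.symm)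
  have hyV : y ∉ Vh.toSubgroup.comap ιG.toMonoidHom := fun h => hVh h rfl
  -- `W := ιG⁻¹ Vh`: open, finite index in the chart
  set W : Subgroup (T.chart i).G := Vh.toSubgroup.comap ιG.toMonoidHom with hWdef
  have hWo : IsOpen (W : Set (T.chart i).G) := hιG.isOpen_comap Vh
  haveI : Finite (P ⧸ Vh.toSubgroup) := Subgroup.quotient_finite_of_isOpen _ Vh.isOpen'
  have hWfi : W.FiniteIndex := by
    refine ⟨fun h0 => ?_⟩
    rw [hWdef, Subgroup.index_comap] at h0
    exact Subgroup.index_ne_zero_of_finite (Subgroup.index_eq_zero_of_relIndex_eq_zero h0)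
  -- `U₀ := adm_i⁻¹ W ≤ N_i`, then `U := U₀` read in `Δ^temp_X`: open, finite index, contains `admKer_i`, misses `δ`
  set U : Subgroup X.DeltaTemp := (W.comap (T.adm i).toMonoidHom).map (T.N i).subtype with hUdef
  have hUle : U ≤ T.N i := by
    rintro _ ⟨u, -, rfl⟩; exact u.2
  have hUo : IsOpen (U : Set X.DeltaTemp) := by
    have h1 : IsOpen ((W.comap (T.adm i).toMonoidHom : Subgroup (T.N i)) : Set (T.N i)) :=
      hWo.preimage (T.adm i).continuous
    have h2 : IsOpenMap (Subtype.val : T.N i → X.DeltaTemp) := (T.isOpen_N i).isOpenMap_subtype_val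
    have : (U : Set X.DeltaTemp) = Subtype.val '' ((W.comap (T.adm i).toMonoidHom : Subgroup (T.N i)) : Set (T.N i)) := by
      rw [hUdef, Subgroup.coe_map]; rfl
    rw [this]; exact h2 _ h1
  haveI hUfi : U.FiniteIndex := by
    have hW' : (W.comap (T.adm i).toMonoidHom).FiniteIndex := ⟨by
      rw [Subgroup.index_comap_of_surjective _ (T.adm_surjective i)]; exact hWfi.index_ne_zero⟩
    refine ⟨?_⟩
    rw [hUdef, Subgroup.index_map_subtype]
    exact mul_ne_zero hW'.index_ne_zero (T.N_finiteIndex i).index_ne_zero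
  have hAU : T.admKer i ≤ U := by
    intro a ha
    have hker : (⟨a, T.admKer_le i ha⟩ : T.N i) ∈ (T.adm i).toMonoidHom.ker := by
      rw [T.ker_adm i, Subgroup.mem_subgroupOf]; exact ha
    rw [MonoidHom.mem_ker] at hker
    refine ⟨⟨a, T.admKer_le i ha⟩, ?_, rfl⟩
    show (⟨a, T.admKer_le i ha⟩ : T.N i) ∈ W.comap (T.adm i).toMonoidHom
    rw [Subgroup.mem_comap, hker]
    exact W.one_mem
  have hδU : δ ∉ U := by
    rintro ⟨u, hu, hue⟩
    have : u = ⟨δ, hNi⟩ := Subtype.ext hue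
    subst this
    exact hyV hu
  -- the normal core `C` of `U`: open, normal, finite index, `admKer_i ≤ C ≤ U`
  haveI : (T.admKer i).Normal := T.admKer_normal i
  have hCle : T.admKer i ≤ U.normalCore := Subgroup.normal_le_normalCore.mpr hAU
  have hCo : IsOpen (U.normalCore : Set X.DeltaTemp) :=
    U.normalCore.isOpen_of_isClosed_of_finiteIndex
      (U.normalCore_isClosed (Subgroup.isClosed_of_isOpen U hUo))
  let Cn : OpenNormalSubgroup X.DeltaTemp :=
    { toOpenSubgroup := ⟨U.normalCore, hCo⟩, isNormal' := Subgroup.normalCore_normal U }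
  obtain ⟨V, hV⟩ := hΔc.comap_surjective Cn inferInstance
  -- `O := deltaToHat(U) · V`, an open subgroup of `Δ_X` containing `deltaToHat(admKer_i)`
  haveI : V.toSubgroup.Normal := V.isNormal'
  set O : Subgroup X.DeltaHat := U.map X.deltaToHat.toMonoidHom ⊔ V.toSubgroup with hOdef
  have hOo : IsOpen (O : Set X.DeltaHat) := Subgroup.isOpen_mono le_sup_right V.isOpen'
  have hAO : (T.admKer i).map X.deltaToHat.toMonoidHom ≤ O :=
    (Subgroup.map_mono hAU).trans le_sup_left
  have hδO : X.deltaToHat δ ∈ O :=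
    (Subgroup.topologicalClosure_minimal _ hAO (Subgroup.isClosed_of_isOpen O hOo)) hδcl
  -- unfold `O = deltaToHat(U) · V`: `δ(u⁻¹ δ) = v ∈ V`, so `u⁻¹ δ ∈ normalCore U ≤ U`, so `δ ∈ U`
  have hmem : (X.deltaToHat δ) ∈ ((U.map X.deltaToHat.toMonoidHom : Subgroup X.DeltaHat) : Set X.DeltaHat) *
      (V.toSubgroup : Set X.DeltaHat) := by
    rw [← Subgroup.mul_normal]; exact hδO
  obtain ⟨_, ⟨u, hu, rfl⟩, v, hv, huv⟩ := Set.mem_mul.mp hmem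
  have h1 : X.deltaToHat (u⁻¹ * δ) ∈ V.toSubgroup := by
    have : X.deltaToHat (u⁻¹ * δ) = v := by
      rw [map_mul, map_inv, ← huv]
      change (X.deltaToHat u)⁻¹ * (X.deltaToHat u * v) = v
      rw [inv_mul_cancel_left]
    rw [this]; exact hv
  have h2 : u⁻¹ * δ ∈ U.normalCore := by
    have : u⁻¹ * δ ∈ Cn.toSubgroup := by rw [hV]; exact h1
    exact this
  have h3 : δ ∈ U := by
    have := U.mul_mem hu (U.normalCore_le h2)
    rwa [mul_inv_cancel_left] at this
  exact hδU h3

/-! ### `⋂_i Ker(Δ̂_X ↠ Π̂_{𝔾*_i}) = 1` from the cofinality of the levels -/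

/-- **Separation**: if the levels `N_i` are COFINAL among the open normal finite-index subgroups of
`Δ^temp_X` ("by allowing `J` to vary", p. 50 l. 40; the hypothesis `hcof` of abc-iut-L5-t11's tower laws),
then `⋂_i closure ι(admKer_i) = 1` in `Π_{X_K}`: each open normal subgroup of the profinite `Δ_X` pulls
back to such a subgroup of `Δ^temp_X`, hence contains some `N_i ⊇ admKer_i`, hence the closure.
([IUTchI] Prop 2.4(ii) p.51) [claim: Mochizuki2012, status: disputed] -/
theorem eq_one_of_forall_mem_admKerHat (d : X.GroupLevelData)
    (hcof : ∀ U : Subgroup X.DeltaTemp, IsOpen (U : Set X.DeltaTemp) → U.Normal → U.FiniteIndex →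
      ∃ i, T.N i ≤ U)
    (δ : X.PiHat) (hδ : ∀ i, δ ∈ admKerHat X T i) : δ = 1 := by
  have hΔc := X.isProfiniteCompletion_deltaToHat d
  haveI : CompactSpace X.DeltaHat := hΔc.compactSpace
  haveI : T2Space X.DeltaHat := hΔc.t2Space
  haveI : TotallyDisconnectedSpace X.DeltaHat := hΔc.totallyDisconnectedSpace
  have hδΔ : δ ∈ X.DeltaHat := admKerHat_le_deltaHat X T 0 (hδ 0)
  set x : X.DeltaHat := ⟨δ, hδΔ⟩ with hxdef
  -- `x` lies in every open normal subgroup of `Δ_X`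
  have hxV : ∀ V : OpenNormalSubgroup X.DeltaHat, x ∈ V := by
    intro V
    haveI : V.toSubgroup.Normal := V.isNormal'
    haveI : Finite (X.DeltaHat ⧸ V.toSubgroup) := Subgroup.quotient_finite_of_isOpen _ V.isOpen'
    let U : Subgroup X.DeltaTemp := V.toSubgroup.comap X.deltaToHat.toMonoidHom
    have hUo : IsOpen (U : Set X.DeltaTemp) := hΔc.isOpen_comap V
    haveI hUn : U.Normal := Subgroup.Normal.comap inferInstance _
    have hUfi : U.FiniteIndex := by
      refine ⟨fun h0 => ?_⟩
      rw [Subgroup.index_comap] at h0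
      exact Subgroup.index_ne_zero_of_finite (Subgroup.index_eq_zero_of_relIndex_eq_zero h0)
    obtain ⟨i, hi⟩ := hcof U hUo hUn hUfi
    have hAV : (T.admKer i).map X.deltaToHat.toMonoidHom ≤ V.toSubgroup := by
      rw [Subgroup.map_le_iff_le_comap]
      exact (T.admKer_le i).trans hi
    have hx : x ∈ ((T.admKer i).map X.deltaToHat.toMonoidHom).topologicalClosure :=
      mem_closure_deltaToHat_of_coe_mem X (T.admKer i) x (hδ i)
    exact (Subgroup.topologicalClosure_minimal _ hAV (OpenSubgroup.isClosed V.toOpenSubgroup)) hx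
  -- a profinite group is separated by its open normal subgroups
  have hx1 : x = 1 := by
    by_contra hne
    obtain ⟨V, hV⟩ := ProfiniteGrp.exist_openNormalSubgroup_sub_open_nhds_of_one
      (isOpen_compl_singleton (x := x)) (show (1 : X.DeltaHat) ∈ ({x}ᶜ : Set X.DeltaHat) from
        fun h => hne h.symm)
    exact hV (hxV V) rfl
  have := congrArg Subtype.val hx1
  exact this

/-! ### The level quotient pairs and the quotient tower of Prop. 2.4 (ii) -/

section Tower

variable (d : X.GroupLevelData) (S : SpecialFibreData (X.toTemperedArithmeticGroup d))
  (h36 : S.Gc.Prop36Hypotheses)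
  (Sigma SigmaHat : Set ℕ) (hsub : Sigma ⊆ SigmaHat) (hne : Sigma.Nonempty)
  (hprime : ∀ q ∈ SigmaHat, q.Prime) (hp : p ∉ Sigma)
  (TpH : Subgroup S.chart.G)
  (HatH : Subgroup (TemperedGraphGroupData.exists_completion_of_prop36 S.Gc h36 S.chart).choose)
  (hle : TpH.map (TemperedGraphGroupData.exists_completion_of_prop36 S.Gc h36
    S.chart).choose_spec.choose.toMonoidHom ≤ HatH)
  (cuspMeetsH : {x : X.Pt // X.IsCusp x} → Prop)
  (hP0 : ∀ i, (admKerPi X T i).Normal)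

/-- **The level-`i` quotient pair `Π^tp_X/Ker(J ↠ Π^tp_{𝔾*_J}) ↪ Π̂_X/Ker(Δ̂_X ↠ Π̂_{𝔾*_J})`** (p. 51 l. 1–3)
at `J = N_i`, as 𝔾-level data: `Tp := Π^temp_{X_K} ⧸ admKer_i`, `Hat := Π_{X_K} ⧸ closure ι(admKer_i)`
(compact), `ι` the induced map — continuous and INJECTIVE (`comap_admKerHat`); the prime-set labels are
those of the datum; `Π^tp_ℍ, Π̂_ℍ := ⊤` (assertion (ii) involves no `ℍ`).  MODULO (P0): the quotients are
groups because `admKer_i ⊴ Π^temp_{X_K}` (`hP0`). ([IUTchI] Prop 2.4(ii) p.51) [claim: Mochizuki2012, status: disputed] -/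
def levelQuotient (i : ℕ) : TemperedGraphGroupData.{0} :=
  haveI : (admKerPi X T i).Normal := hP0 i
  haveI : (admKerHat X T i).Normal := admKerHat_normal X T i (hP0 i)
  haveI : CompactSpace X.PiHat := X.isProfiniteCompletion_toHat.compactSpace
  { Sigma := Sigma
    SigmaHat := SigmaHat
    sigma_subset := hsub
    sigma_nonempty := hne
    sigmaHat_prime := hprime
    Tp := X.PiTemp ⧸ admKerPi X T i
    Hat := X.PiHat ⧸ admKerHat X T i
    ι := QuotientGroup.map (admKerPi X T i) (admKerHat X T i) X.toHat.toMonoidHom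
      (admKerPi_le_comap_admKerHat X T i)
    ι_continuous := by
      refine (QuotientGroup.isOpenQuotientMap_mk.continuous_comp_iff).mp ?_
      exact QuotientGroup.continuous_mk.comp X.toHat.continuous
    ι_injective := by
      rw [← MonoidHom.ker_eq_bot_iff, eq_bot_iff]
      intro q hq
      induction q using QuotientGroup.induction_on with
      | H t =>
        rw [MonoidHom.mem_ker, QuotientGroup.map_mk, QuotientGroup.eq_one_iff] at hq
        rw [Subgroup.mem_bot, QuotientGroup.eq_one_iff, ← comap_admKerHat X T d i]
        exact hq
    TpH := ⊤
    HatH := ⊤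
    tpH_le := le_top }

/-- `Π^tp` of the level quotient is `Π^temp_{X_K} ⧸ admKer_i` (definitional).
([IUTchI] Prop 2.4(ii) p.51) [claim: Mochizuki2012, status: disputed] -/
theorem levelQuotient_Tp (i : ℕ) :
    (levelQuotient X T d Sigma SigmaHat hsub hne hprime hP0 i).Tp = (X.PiTemp ⧸ admKerPi X T i) := rfl

/-- **NV-L5 `Prop24QTower` at the GENUINE datum, `_model` modulo (P0): the quotient tower of the proof of
[IUTchI] Prop. 2.4 (ii)** over abc-iut-L5-t11's 𝔛-datum `ofSpecialFibre X d S …` — levels `ℕ` (the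
levels `N_i` of the special-fibre tower), level quotient pairs `levelQuotient`, and `qtp`, `qhat` the
quotient maps `Π^temp_{X_K} ↠ Π^temp_{X_K}/admKer_i`, `Π_{X_K} ↠ Π_{X_K}/closure ι(admKer_i)`, compatible by
construction. ([IUTchI] Prop 2.4(ii) pp.50-51) [claim: Mochizuki2012, status: disputed] -/
def qTowerOfSpecialFibreTower :
    (ofSpecialFibre X d S h36 Sigma SigmaHat hsub hne hprime hp TpH HatH hle cuspMeetsH).Prop24QTower where
  I := ℕ
  Q := levelQuotient X T d Sigma SigmaHat hsub hne hprime hP0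
  qtp i := by
    haveI : (admKerPi X T i).Normal := hP0 i
    exact QuotientGroup.mk' (admKerPi X T i)
  qhat i := by
    haveI : (admKerHat X T i).Normal := admKerHat_normal X T i (hP0 i)
    exact QuotientGroup.mk' (admKerHat X T i)
  hq _ _ := rfl

/-- The kernel of the level-`i` profinite quotient map is `closure ι(admKer_i)`.
([IUTchI] Prop 2.4(ii) p.51) [claim: Mochizuki2012, status: disputed] -/
theorem qTower_qhat_ker (i : ℕ) :
    ((qTowerOfSpecialFibreTower X T d S h36 Sigma SigmaHat hsub hne hprime hp TpH HatH hle cuspMeetsH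
      hP0).qhat i).ker = admKerHat X T i := by
  haveI : (admKerHat X T i).Normal := admKerHat_normal X T i (hP0 i)
  exact QuotientGroup.ker_mk' _

/-- The level-`i` tempered quotient map is surjective. ([IUTchI] Prop 2.4(ii) p.51) [claim: Mochizuki2012, status: disputed] -/
theorem qTower_qtp_surjective (i : ℕ) :
    Function.Surjective ((qTowerOfSpecialFibreTower X T d S h36 Sigma SigmaHat hsub hne hprime hp TpH
      HatH hle cuspMeetsH hP0).qtp i) := by
  haveI : (admKerPi X T i).Normal := hP0 i
  exact QuotientGroup.mk'_surjective _

/-- **The law (INV) `QDetectsTempered` for the genuine quotient tower** ("just as in the proof of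
assertion (i) … `γ` lies in `Π^tp_X`", p. 51 l. 6–13), by abc-iut-w4-d055's
`qDetectsTempered_of_inverseLimit`: `hsurj` is automatic, the separation `⋂_i Ker q̂_i = 1` is PROVED
from the cofinality of the levels (`eq_one_of_forall_mem_admKerHat`), and `hlim` — the tempered
completeness "`Π^tp_X = lim Π^tp_X/Ker(J ↠ Π^tp_{𝔾*_J})`" (p. 51 l. 8–10) in coset form — stays a named
binder. ([IUTchI] Prop 2.4(ii) p.51) [claim: Mochizuki2012, status: disputed] -/
theorem qTower_qDetectsTempered
    (hcof : ∀ U : Subgroup X.DeltaTemp, IsOpen (U : Set X.DeltaTemp) → U.Normal → U.FiniteIndex →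
      ∃ i, T.N i ≤ U)
    (hlim : ∀ t : ℕ → X.PiTemp,
      (∀ j k, admKerHat X T k ≤ admKerHat X T j → X.toHat ((t j)⁻¹ * t k) ∈ admKerHat X T j) →
      ∃ s : X.PiTemp, ∀ j, X.toHat (s⁻¹ * t j) ∈ admKerHat X T j) :
    (qTowerOfSpecialFibreTower X T d S h36 Sigma SigmaHat hsub hne hprime hp TpH HatH hle cuspMeetsH
      hP0).QDetectsTempered := by
  refine Prop24QTower.qDetectsTempered_of_inverseLimit _
    (qTower_qtp_surjective X T d S h36 Sigma SigmaHat hsub hne hprime hp TpH HatH hle cuspMeetsH hP0)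
    ?_ ?_
  · intro t ht
    have ht' : ∀ j k, admKerHat X T k ≤ admKerHat X T j → X.toHat ((t j)⁻¹ * t k) ∈ admKerHat X T j := by
      intro j k hjk
      have := ht j k (by rw [qTower_qhat_ker, qTower_qhat_ker]; exact hjk)
      rw [qTower_qhat_ker] at this
      exact this
    obtain ⟨s, hs⟩ := hlim t ht'
    exact ⟨s, fun j => by rw [qTower_qhat_ker]; exact hs j⟩
  · intro δ hδ
    refine eq_one_of_forall_mem_admKerHat X T d hcof δ fun i => ?_
    have := hδ i
    rw [← MonoidHom.mem_ker, qTower_qhat_ker] at this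
    exact this

/-- **[IUTchI] Prop. 2.4 (ii) AS TYPED at the genuine 𝔛-datum**, from the per-level arithmetic Prop. 2.1
(`LevelObservation`, the analytic input = [SemiAnbd] Thm 5.4 (ii) / Ex 5.6 for the quotients) + (P0) +
the cofinality of the levels + tempered completeness, through abc-iut-w5-d119's `prop24ii_of_qtower`.
([IUTchI] Prop 2.4(ii) pp.50-51) [claim: Mochizuki2012, status: disputed] -/
theorem prop24ii_ofSpecialFibre_of_qTower
    (hcof : ∀ U : Subgroup X.DeltaTemp, IsOpen (U : Set X.DeltaTemp) → U.Normal → U.FiniteIndex →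
      ∃ i, T.N i ≤ U)
    (hlim : ∀ t : ℕ → X.PiTemp,
      (∀ j k, admKerHat X T k ≤ admKerHat X T j → X.toHat ((t j)⁻¹ * t k) ∈ admKerHat X T j) →
      ∃ s : X.PiTemp, ∀ j, X.toHat (s⁻¹ * t j) ∈ admKerHat X T j)
    (hLev : (qTowerOfSpecialFibreTower X T d S h36 Sigma SigmaHat hsub hne hprime hp TpH HatH hle
      cuspMeetsH hP0).LevelObservation) :
    (ofSpecialFibre X d S h36 Sigma SigmaHat hsub hne hprime hp TpH HatH hle cuspMeetsH).Prop24ii :=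
  (qTowerOfSpecialFibreTower X T d S h36 Sigma SigmaHat hsub hne hprime hp TpH HatH hle cuspMeetsH
    hP0).prop24ii_of_qtower hLev
    (qTower_qDetectsTempered X T d S h36 Sigma SigmaHat hsub hne hprime hp TpH HatH hle cuspMeetsH hP0
      hcof hlim)

end Tower

end OfSpecialFibre

end StableCurveTemperedData

end Literature.IUT.HodgeTheaters

end
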